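import Literature.Analysis.FluidPDE.FracNSGalerkin
import Literature.Analysis.FluidPDE.FracNSGalerkinExistence
import Literature.Analysis.FluidPDE.NSHopfLimit
import HarnessLib

/-!
# Fractional Navier–Stokes on `T^d`: compactness of a fractional Galerkin scheme
  (proof of the named fact `fracGalerkin_limit`, part 1: bounds, modulus, extraction)

Analysis/FluidPDE. First module of the proof of the named fact
`Literature.Analysis.FluidPDE.fracGalerkin_limit` (`Literature/Analysis/FluidPDE/FracNSGalerkin`;
Colombo–De Lellis–De Rosa 2018, §9, proof of Thm. 1.1, second half: "the sequence `{w_K}` is thus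
bounded in `L²(T³ × [0,T])` … we can extract a subsequence … the proof follows a classical
Aubin–Lions type argument"), carried out — exactly as the tree's `α = 1` development `NSHopfLimit`
(Hopf's method, Robinson–Rodrigo–Sadowski 2016, Thm. 4.4 Step 3, Ex. 4.2–4.4) — on the Fourier side,
for a fractional Galerkin scheme `IsFracGalerkinScheme α u₀ N U` (any real `α`, any dimension):

* **slices** of a scheme: continuity, `L²`, finite Parseval sums, transversality, reality, the
  datum in Fourier variables `Û_n(0,k) = û₀(k)` for `|k| ≤ N n`;
* **L1, uniform bounds** (CDLDR §9: `½∫|w_K|²(t) + ∫₀ᵗ∫|(-Δ)^{α/2}w_K|² = ½∫|P_K v̄|² ≤ ½∫|v̄|²`):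
  `∫‖U n t‖² ≤ ∫‖u₀‖²` for every `t ≥ 0` and `∫ₛᵗ D_α(U n) ≤ ½∫‖U n s‖² ≤ ½∫‖u₀‖²` — there is no
  force, so no `T`-dependence;
* the **eigenmode identity** `(-Δ)^α Re(e_k z) = (4π²|k|²)^α Re(e_k z)` for single real modes;
* **L2, modulus of continuity** of the Fourier coefficients from the tested Galerkin equations
  (test mode `Re(e_k (Û_n(t,k) - Û_n(s,k)))`): `‖Û_n(t,k) - Û_n(s,k)‖² ≤ K_k (t - s)`;
* **L3, extraction** of a diagonal subsequence converging at every time `t ≥ 0` and frequency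
  (Tychonoff at rational times + the uniform modulus), and the limit coefficients: `c 0 = û₀`,
  transversal, conjugate symmetric, `∑_{k∈S} ‖c t k‖² ≤ ∫‖u₀‖²`, continuous in `t`.

Theorem-only module; the sequels are `FracNSGalerkinLimitField` (limit field, Fatou, Friedrichs),
`FracNSGalerkinEnergy`, `FracNSGalerkinWeakForm`, `FracNSGalerkinLimit`.

## References

* M. Colombo, C. De Lellis, L. De Rosa, *Ill-posedness of Leray solutions for the hypodissipative
  Navier–Stokes equations*, Comm. Math. Phys. 362 (2018), §9 (proof of Thm. 1.1).
  [`ColomboDelellisDerosa2018`]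
* J. C. Robinson, J. L. Rodrigo, W. Sadowski, *The three-dimensional Navier–Stokes equations*
  (CUP 2016), Thm. 4.4 Step 3, (4.8)–(4.13), Exercises 4.2–4.4 (the `α = 1` template).
  [`RobinsonRodrigoSadowski2016`]
* E. Hopf, Math. Nachr. 4 (1951), §4. [`Hopf1951`]
-/

noncomputable section

open MeasureTheory Set Filter Topology UnitAddTorus Function
open scoped ENNReal NNReal InnerProductSpace RealInnerProductSpace

namespace Literature.Analysis.FluidPDE

variable {d : Type*} [Fintype d] [DecidableEq d]

/-! ## The fractional Laplacian on single real modes -/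

namespace Torus

omit [DecidableEq d] in
/-- **Single real modes are eigenfunctions of `(-Δ)^α`**: for every frequency `k`, vector
`z = c k ∈ ℂ^d`, and every real `θ`, `(-Δ)^θ Re(e_k • z) = (4π²|k|²)^θ Re(e_k • z)` pointwise
(the Fourier coefficients of `Re(e_k • z)` are `½ z` at `k` and `½ z̄` at `-k`,
`Torus.mFourierCoeff_realTrigPoly_singleton`; the symbol is even; `Re ∘ conj = Re`). At `k = 0`
both sides are `σ_θ(0) Re z`. (Grafakos 2014, Prop. 3.2.6 (8) for Fourier multipliers.) [folklore] -/
theorem fracLaplacian_realTrigPoly_singleton [DecidableEq d] (θ : ℝ) (k : d → ℤ)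
    (c : (d → ℤ) → EuclideanSpace ℂ d) (x : UnitAddTorus d) :
    fracLaplacian θ (FunctionSpaces.Torus.realTrigPoly {k} c) x =
      fracSymbol θ k • FunctionSpaces.Torus.realTrigPoly {k} c x := by
  -- split the summand into the `k`-part `A` and the `-k`-part `B`
  set A : (d → ℤ) → EuclideanSpace ℂ d := fun k' =>
    fracSymbol θ k' • (mFourier k' x • ((2 : ℂ)⁻¹ • (if k' = k then c k else 0))) with hA
  set B : (d → ℤ) → EuclideanSpace ℂ d := fun k' =>
    fracSymbol θ k' • (mFourier k' x • ((2 : ℂ)⁻¹ •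
      FunctionSpaces.EuclideanSpace.conjVec (if k' = -k then c k else 0))) with hB
  have key : ∀ k', fracSymbol θ k' • (mFourier k' x •
      mFourierCoeff (FunctionSpaces.EuclideanSpace.complexify ∘ FunctionSpaces.Torus.realTrigPoly {k} c) k') =
      A k' + B k' := by
    intro k'
    rw [FunctionSpaces.Torus.mFourierCoeff_realTrigPoly_singleton k c k']
    simp only [hA, hB, smul_add]
  have hA0 : ∀ k', k' ≠ k → A k' = 0 := fun k' hk' => by
    simp only [hA, if_neg hk', smul_zero]
  have hB0 : ∀ k', k' ≠ -k → B k' = 0 := fun k' hk' => by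
    simp only [hB, if_neg hk', FunctionSpaces.EuclideanSpace.conjVec_zero, smul_zero]
  have hAs : HasSum A (A k) := hasSum_single k hA0
  have hBs : HasSum B (B (-k)) := hasSum_single (-k) hB0
  -- the two surviving terms
  have hAk : A k = mFourier k x • (((fracSymbol θ k : ℝ) : ℂ) • ((2 : ℂ)⁻¹ • c k)) := by
    simp only [hA]
    rw [if_pos True.intro, fracSymbol_smul_mFourier_smul]
  have hBk : B (-k) = FunctionSpaces.EuclideanSpace.conjVec (A k) := by
    rw [hAk]
    simp only [hB]
    rw [if_pos True.intro, fracSymbol_smul_mFourier_smul, fracSymbol_neg, FunctionSpaces.EuclideanSpace.conjVec_smul,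
      FunctionSpaces.EuclideanSpace.conjVec_smul, FunctionSpaces.EuclideanSpace.conjVec_smul, Complex.conj_ofReal,
      mFourier_neg, map_inv₀, map_ofNat]
  have hfin : ∀ w : EuclideanSpace ℂ d,
      FunctionSpaces.EuclideanSpace.realPart (mFourier k x • (((fracSymbol θ k : ℝ) : ℂ) • ((2 : ℂ)⁻¹ • w))) +
        FunctionSpaces.EuclideanSpace.realPart (mFourier k x • (((fracSymbol θ k : ℝ) : ℂ) • ((2 : ℂ)⁻¹ • w))) =
      fracSymbol θ k • FunctionSpaces.EuclideanSpace.realPart (mFourier k x • w) := by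
    intro w
    rw [← map_add, ← smul_add, ← smul_add, ← add_smul, show (2 : ℂ)⁻¹ + 2⁻¹ = 1 by norm_num, one_smul,
      smul_comm (mFourier k x) (((fracSymbol θ k : ℝ) : ℂ)) w, Complex.coe_smul, map_smul]
  rw [fracLaplacian_def]
  simp_rw [key]
  rw [(hAs.add hBs).tsum_eq, map_add, hBk, FunctionSpaces.EuclideanSpace.realPart_conjVec, hAk,
    FunctionSpaces.Torus.realTrigPoly_singleton_apply, hfin]

end Torus

/-! ## Slices of a scheme -/

section SchemeSlices

variable {α : ℝ} {u₀ : UnitAddTorus d → EuclideanSpace ℝ d} {N : ℕ → ℕ}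
  {U : ℕ → ℝ → UnitAddTorus d → EuclideanSpace ℝ d}

/-- Slices `U n t`, `t ≥ 0`, of a fractional Galerkin scheme are continuous. [folklore] -/
theorem IsFracGalerkinScheme.continuous_slice (hS : IsFracGalerkinScheme α u₀ N U) (n : ℕ)
    {t : ℝ} (ht : 0 ≤ t) : Continuous (U n t) :=
  FunctionSpaces.Torus.continuous_slice_of_continuousOn_stLift (hS.continuousOn n) (mem_Ici.2 ht)

/-- Slices `U n t`, `t ≥ 0`, are in `L²`. [folklore] -/
theorem IsFracGalerkinScheme.memLp_slice (hS : IsFracGalerkinScheme α u₀ N U) (n : ℕ)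
    {t : ℝ} (ht : 0 ≤ t) : MemLp (U n t) 2 volume :=
  (hS.continuous_slice n ht).memLp_of_hasCompactSupport (HasCompactSupport.of_compactSpace _)

/-- **Slice energies are finite Parseval sums**: `∫ ‖U n t‖² = ∑_{|k| ≤ N n} ‖Û_n(t,k)‖²`. [folklore] -/
theorem IsFracGalerkinScheme.integral_norm_sq_eq_sum (hS : IsFracGalerkinScheme α u₀ N U)
    (n : ℕ) {t : ℝ} (ht : 0 ≤ t) :
    ∫ x, ‖U n t x‖ ^ 2 = ∑ k ∈ FunctionSpaces.Torus.freqBall (N n),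
      ‖mFourierCoeff (FunctionSpaces.EuclideanSpace.complexify ∘ U n t) k‖ ^ 2 :=
  FunctionSpaces.Torus.integral_norm_sq_eq_sum_of_band_limited (hS.continuous_slice n ht)
    fun _ hk => (hS.isGalerkinMode n t ht).mFourierCoeff_eq_zero hk

/-- Each Fourier coefficient of a slice is controlled by the slice energy:
`‖Û_n(t,k)‖² ≤ ∫ ‖U n t‖²`. [folklore] -/
theorem IsFracGalerkinScheme.norm_mFourierCoeff_sq_le (hS : IsFracGalerkinScheme α u₀ N U)
    (n : ℕ) {t : ℝ} (ht : 0 ≤ t) (k : d → ℤ) :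
    ‖mFourierCoeff (FunctionSpaces.EuclideanSpace.complexify ∘ U n t) k‖ ^ 2 ≤ ∫ x, ‖U n t x‖ ^ 2 := by
  rw [hS.integral_norm_sq_eq_sum n ht]
  by_cases hk : k ∈ FunctionSpaces.Torus.freqBall (N n)
  · exact Finset.single_le_sum (f := fun k =>
      ‖mFourierCoeff (FunctionSpaces.EuclideanSpace.complexify ∘ U n t) k‖ ^ 2) (fun _ _ => sq_nonneg _) hk
  · rw [(hS.isGalerkinMode n t ht).mFourierCoeff_eq_zero (FunctionSpaces.Torus.not_mem_freqBall.1 hk), norm_zero,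
      zero_pow two_ne_zero]
    exact Finset.sum_nonneg fun _ _ => sq_nonneg _

/-- The Fourier coefficients of the slices are transversal: `∑ⱼ kⱼ Û_n(t,k)ⱼ = 0`. [folklore] -/
theorem IsFracGalerkinScheme.sum_mul_mFourierCoeff_eq_zero
    (hS : IsFracGalerkinScheme α u₀ N U) (n : ℕ) {t : ℝ} (ht : 0 ≤ t) (k : d → ℤ) :
    ∑ j, (k j : ℂ) * mFourierCoeff (FunctionSpaces.EuclideanSpace.complexify ∘ U n t) k j = 0 :=
  (hS.isGalerkinMode n t ht).isDivFree.sum_mul_mFourierCoeff_eq_zero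
    (hS.isGalerkinMode n t ht).isSmooth k

/-- The Fourier coefficients of the slices are conjugate symmetric (real fields). [folklore] -/
theorem IsFracGalerkinScheme.isConjSymm_mFourierCoeff (hS : IsFracGalerkinScheme α u₀ N U)
    (n : ℕ) {t : ℝ} (ht : 0 ≤ t) :
    FunctionSpaces.Torus.IsConjSymm fun k => mFourierCoeff (FunctionSpaces.EuclideanSpace.complexify ∘ U n t) k :=
  FunctionSpaces.Torus.isConjSymm_mFourierCoeff (hS.continuous_slice n ht).integrable_unitAddTorus

/-- **The datum in Fourier variables**: `Û_n(0, k) = û₀(k)` for every `|k| ≤ N n` (test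
`initial_inner` against the single real mode at `k` with vector the difference of the two
coefficients, transversal as both fields are (weakly) divergence free; CDLDR 2018, §9:
`w(·,0) = P_K v̄`). [folklore] -/
theorem IsFracGalerkinScheme.mFourierCoeff_zero_eq (hS : IsFracGalerkinScheme α u₀ N U)
    (hu₀ : MemLp u₀ 2 volume) (hdiv : FunctionSpaces.Torus.IsWeaklyDivFree u₀) (n : ℕ) {k : d → ℤ}
    (hk : k ∈ FunctionSpaces.Torus.freqBall (N n)) :
    mFourierCoeff (FunctionSpaces.EuclideanSpace.complexify ∘ U n 0) k =
      mFourierCoeff (FunctionSpaces.EuclideanSpace.complexify ∘ u₀) k := by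
  set z : EuclideanSpace ℂ d := mFourierCoeff (FunctionSpaces.EuclideanSpace.complexify ∘ U n 0) k -
    mFourierCoeff (FunctionSpaces.EuclideanSpace.complexify ∘ u₀) k with hz
  have hzT : ∑ j, (k j : ℂ) * z j = 0 := by
    simp only [hz, PiLp.sub_apply, mul_sub, Finset.sum_sub_distrib]
    rw [hS.sum_mul_mFourierCoeff_eq_zero n le_rfl k,
      hdiv.sum_mul_mFourierCoeff_eq_zero hu₀ k, sub_zero]
  have hmode : IsGalerkinMode (N n) (FunctionSpaces.Torus.realTrigPoly {k} fun _ => z) :=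
    isGalerkinMode_realTrigPoly_singleton hk hzT
  have h := hS.initial_inner n _ hmode
  rw [FunctionSpaces.Torus.integral_inner_realTrigPoly_singleton (hS.continuous_slice n le_rfl).integrable_unitAddTorus,
    FunctionSpaces.Torus.integral_inner_realTrigPoly_singleton (hu₀.integrable one_le_two)] at h
  have hzz : (inner ℂ z z).re = 0 := by
    have : inner ℂ z z = inner ℂ (mFourierCoeff (FunctionSpaces.EuclideanSpace.complexify ∘ U n 0) k) z -
        inner ℂ (mFourierCoeff (FunctionSpaces.EuclideanSpace.complexify ∘ u₀) k) z := by
      rw [hz, inner_sub_left]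
    rw [this, Complex.sub_re, h, sub_self]
  have hz0 : z = 0 := by
    have h2 : (inner ℂ z z).re = ‖z‖ ^ 2 := by
      rw [inner_self_eq_norm_sq_to_K]; norm_cast
    rw [h2] at hzz
    exact norm_eq_zero.1 (pow_eq_zero_iff two_ne_zero |>.1 hzz)
  exact sub_eq_zero.1 hz0

/-- Measurability in time of the Galerkin coefficients: `t ↦ Û_n(t,k)` is a.e. strongly
measurable on `(0, ∞)` (it is continuous on `[0, ∞)`). [folklore] -/
theorem IsFracGalerkinScheme.aestronglyMeasurable_mFourierCoeff
    (hS : IsFracGalerkinScheme α u₀ N U) (n : ℕ) (k : d → ℤ) :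
    AEStronglyMeasurable (fun t => mFourierCoeff (FunctionSpaces.EuclideanSpace.complexify ∘ U n t) k)
      (volume.restrict (Ioi 0)) :=
  ((FunctionSpaces.Torus.continuousOn_mFourierCoeff_of_continuousOn_stLift (hS.continuousOn n)
    k).aestronglyMeasurable measurableSet_Ici).mono_measure
      (Measure.restrict_mono Ioi_subset_Ici_self le_rfl)

/-- The space–time lift of `U n` is a.e. strongly measurable on `(0, ∞) × ℝ^d`. [folklore] -/
theorem IsFracGalerkinScheme.aestronglyMeasurable_stLift (hS : IsFracGalerkinScheme α u₀ N U) (n : ℕ) :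
    AEStronglyMeasurable (FunctionSpaces.Torus.stLift (U n)) (volume.restrict (Ioi 0 ×ˢ univ)) :=
  ((hS.continuousOn n).aestronglyMeasurable (measurableSet_Ici.prod MeasurableSet.univ)).mono_measure
    (Measure.restrict_mono (prod_mono Ioi_subset_Ici_self subset_rfl) le_rfl)

end SchemeSlices

/-! ## L1: uniform bounds (no force: the energy is non-increasing) -/

section Bounds

variable {α : ℝ} {u₀ : UnitAddTorus d → EuclideanSpace ℝ d} {N : ℕ → ℕ}
  {U : ℕ → ℝ → UnitAddTorus d → EuclideanSpace ℝ d}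

/-- The initial energies are bounded by the energy of the datum: `∫ ‖U n 0‖² ≤ ∫ ‖u₀‖²`
(`⟪U n 0, U n 0⟫ = ⟪u₀, U n 0⟫ ≤ ½‖u₀‖² + ½‖U n 0‖²` from `initial_inner`; CDLDR 2018, §9:
`½∫|P_K v̄|² ≤ ½∫|v̄|²`). [cite: ColomboDelellisDerosa2018, §9 (proof of Thm. 1.1)] -/
theorem IsFracGalerkinScheme.integral_norm_sq_zero_le (hS : IsFracGalerkinScheme α u₀ N U)
    (hu₀ : MemLp u₀ 2 volume) (n : ℕ) :
    ∫ x, ‖U n 0 x‖ ^ 2 ≤ ∫ x, ‖u₀ x‖ ^ 2 := by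
  have h := hS.initial_inner n (U n 0) (hS.isGalerkinMode n 0 le_rfl)
  have hc : Continuous (U n 0) := hS.continuous_slice n le_rfl
  have hself : ∫ x, ⟪U n 0 x, U n 0 x⟫ = ∫ x, ‖U n 0 x‖ ^ 2 :=
    integral_congr_ae (ae_of_all _ fun x => real_inner_self_eq_norm_sq _)
  have hi1 : Integrable (fun x => ‖u₀ x‖ ^ 2) volume := hu₀.integrable_norm_pow two_ne_zero
  have hi2 : Integrable (fun x => ‖U n 0 x‖ ^ 2) volume := (hc.norm.pow 2).integrable_unitAddTorus
  have hyoung : ∫ x, ⟪u₀ x, U n 0 x⟫ ≤ 2⁻¹ * (∫ x, ‖u₀ x‖ ^ 2) + 2⁻¹ * ∫ x, ‖U n 0 x‖ ^ 2 := by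
    rw [← integral_const_mul, ← integral_const_mul, ← integral_add (hi1.const_mul _) (hi2.const_mul _)]
    refine integral_mono (FunctionSpaces.Torus.integrable_inner_of_continuous (hu₀.integrable one_le_two) hc)
      ((hi1.const_mul _).add (hi2.const_mul _)) fun x => ?_
    have := inner_le_young (u₀ x) (U n 0 x) one_pos
    simp only [mul_one, one_div] at this
    exact this
  rw [hself] at h
  rw [← h] at hyoung
  linarith

/-- **L1: uniform energy bound** (CDLDR 2018, §9: `½∫|w_K|²(t) ≤ ½∫|P_K v̄|² ≤ ½∫|v̄|²`): for a
fractional Galerkin scheme, `∫ ‖U n t‖² ≤ ∫ ‖u₀‖²` for every `n` and every `t ≥ 0` (the energy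
identity has non-negative dissipation and there is no force).
[cite: ColomboDelellisDerosa2018, §9 (proof of Thm. 1.1)] -/
theorem IsFracGalerkinScheme.integral_norm_sq_le (hS : IsFracGalerkinScheme α u₀ N U)
    (hu₀ : MemLp u₀ 2 volume) (n : ℕ) {t : ℝ} (ht : 0 ≤ t) :
    ∫ x, ‖U n t x‖ ^ 2 ≤ ∫ x, ‖u₀ x‖ ^ 2 := by
  have h1 := hS.kineticEnergy_le n le_rfl ht
  have h2 := hS.integral_norm_sq_zero_le hu₀ n
  unfold FunctionSpaces.Torus.kineticEnergy at h1
  linarith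

/-- **L1: uniform dissipation bound** (CDLDR 2018, §9: `∫₀ᵗ∫|(-Δ)^{α/2}w_K|² ≤ ½∫|v̄|²`): for
`0 ≤ s ≤ t`, `(∫⁻_{(s,t)} D_α(U n)).toReal ≤ ½ ∫‖U n s‖² ≤ ½ ∫‖u₀‖²`.
[cite: ColomboDelellisDerosa2018, §9 (proof of Thm. 1.1)] -/
theorem IsFracGalerkinScheme.toReal_lintegral_eFracDissipation_le (hS : IsFracGalerkinScheme α u₀ N U)
    (hu₀ : MemLp u₀ 2 volume) (n : ℕ) {s t : ℝ} (hs : 0 ≤ s) (hst : s ≤ t) :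
    (∫⁻ τ in Ioo s t, Torus.eFracDissipation α (U n τ)).toReal ≤ 2⁻¹ * ∫ x, ‖u₀ x‖ ^ 2 := by
  have h1 := hS.energy_eq n s t hs hst
  have h2 := hS.integral_norm_sq_le hu₀ n hs
  have h3 : 0 ≤ FunctionSpaces.Torus.kineticEnergy (U n t) := FunctionSpaces.Torus.kineticEnergy_nonneg _
  unfold FunctionSpaces.Torus.kineticEnergy at h1 h3
  linarith

/-- **Uniform bound on the Fourier coefficients**: `‖Û_n(t,k)‖ ≤ (∫‖u₀‖²)^{1/2}` for all `n`,
`k` and `t ≥ 0`. [folklore] -/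
theorem IsFracGalerkinScheme.norm_mFourierCoeff_le (hS : IsFracGalerkinScheme α u₀ N U)
    (hu₀ : MemLp u₀ 2 volume) (n : ℕ) {t : ℝ} (ht : 0 ≤ t) (k : d → ℤ) :
    ‖mFourierCoeff (FunctionSpaces.EuclideanSpace.complexify ∘ U n t) k‖ ≤ Real.sqrt (∫ x, ‖u₀ x‖ ^ 2) :=
  Real.le_sqrt_of_sq_le ((hS.norm_mFourierCoeff_sq_le n ht k).trans (hS.integral_norm_sq_le hu₀ n ht))

/-- **The fractional dissipation of a Galerkin slice is a finite sum**: for `α ≠ 0` and `t ≥ 0`,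
`D_α(U n t) = ofReal (∑_{|k| ≤ N n} (4π²|k|²)^α ‖Û_n(t,k)‖²)` (the slice is its own truncation,
a real trigonometric polynomial over the ball). [folklore] -/
theorem IsFracGalerkinScheme.eFracDissipation_slice_eq_sum (hS : IsFracGalerkinScheme α u₀ N U)
    (hα : α ≠ 0) (n : ℕ) {t : ℝ} (ht : 0 ≤ t) :
    Torus.eFracDissipation α (U n t) = ENNReal.ofReal (∑ k ∈ FunctionSpaces.Torus.freqBall (N n),
      Torus.fracSymbol α k * ‖mFourierCoeff (FunctionSpaces.EuclideanSpace.complexify ∘ U n t) k‖ ^ 2) := by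
  have hc := hS.continuous_slice n ht
  conv_lhs => rw [← FunctionSpaces.Torus.fourierTruncate_eq_self hc
    (fun k hk => (hS.isGalerkinMode n t ht).mFourierCoeff_eq_zero hk), FunctionSpaces.Torus.fourierTruncate_eq]
  exact eFracDissipation_realTrigPoly hα FunctionSpaces.Torus.neg_mem_freqBall_of_mem
    (FunctionSpaces.Torus.isConjSymm_mFourierCoeff hc.integrable_unitAddTorus)

/-- The fractional dissipation of the Galerkin slices is bounded on `[0, ∞)`:
`D_α(U n t) ≤ ofReal ((∑_{|k|≤N n} σ_α(k)) ∫‖u₀‖²)` (`α ≠ 0`). [folklore] -/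
theorem IsFracGalerkinScheme.eFracDissipation_slice_le (hS : IsFracGalerkinScheme α u₀ N U)
    (hα : α ≠ 0) (hu₀ : MemLp u₀ 2 volume) (n : ℕ) {t : ℝ} (ht : 0 ≤ t) :
    Torus.eFracDissipation α (U n t) ≤ ENNReal.ofReal ((∑ k ∈ FunctionSpaces.Torus.freqBall (d := d) (N n),
      Torus.fracSymbol α k) * ∫ x, ‖u₀ x‖ ^ 2) := by
  rw [hS.eFracDissipation_slice_eq_sum hα n ht, Finset.sum_mul]
  refine ENNReal.ofReal_le_ofReal (Finset.sum_le_sum fun k _ => ?_)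
  exact mul_le_mul_of_nonneg_left ((hS.norm_mFourierCoeff_sq_le n ht k).trans
    (hS.integral_norm_sq_le hu₀ n ht)) (Torus.fracSymbol_nonneg α k)

/-- Measurability in time of the slice dissipation `t ↦ D_α(U n t)` on `(0, T)` (`α ≠ 0`; a
finite sum of continuous functions). [folklore] -/
theorem IsFracGalerkinScheme.aemeasurable_eFracDissipation (hS : IsFracGalerkinScheme α u₀ N U)
    (hα : α ≠ 0) (n : ℕ) (T : ℝ) :
    AEMeasurable (fun t => Torus.eFracDissipation α (U n t)) (volume.restrict (Ioo 0 T)) := by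
  have hcont : ContinuousOn (fun t => ENNReal.ofReal (∑ k ∈ FunctionSpaces.Torus.freqBall (N n),
      Torus.fracSymbol α k * ‖mFourierCoeff (FunctionSpaces.EuclideanSpace.complexify ∘ U n t) k‖ ^ 2)) (Ici 0) :=
    ENNReal.continuous_ofReal.comp_continuousOn (continuousOn_finsetSum _ fun k _ =>
      continuousOn_const.mul ((FunctionSpaces.Torus.continuousOn_mFourierCoeff_of_continuousOn_stLift
        (hS.continuousOn n) k).norm.pow 2))
  refine ((hcont.mono fun t ht => mem_Ici.2 (le_of_lt ht.1)).aemeasurable measurableSet_Ioo).congr ?_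
  filter_upwards [ae_restrict_mem measurableSet_Ioo] with t ht
  exact (hS.eFracDissipation_slice_eq_sum hα n ht.1.le).symm

/-- The dissipation integral of a Galerkin approximation over `(0, T)` is finite (`α ≠ 0`). [folklore] -/
theorem IsFracGalerkinScheme.lintegral_eFracDissipation_lt_top (hS : IsFracGalerkinScheme α u₀ N U)
    (hα : α ≠ 0) (hu₀ : MemLp u₀ 2 volume) (n : ℕ) (T : ℝ) :
    ∫⁻ t in Ioo 0 T, Torus.eFracDissipation α (U n t) < ⊤ := by
  calc ∫⁻ t in Ioo 0 T, Torus.eFracDissipation α (U n t)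
      ≤ ∫⁻ _ in Ioo 0 T, ENNReal.ofReal ((∑ k ∈ FunctionSpaces.Torus.freqBall (d := d) (N n),
          Torus.fracSymbol α k) * ∫ x, ‖u₀ x‖ ^ 2) :=
        setLIntegral_mono' measurableSet_Ioo fun t ht => hS.eFracDissipation_slice_le hα hu₀ n ht.1.le
    _ < ⊤ := by
        rw [setLIntegral_const]
        exact ENNReal.mul_lt_top ENNReal.ofReal_lt_top measure_Ioo_lt_top

/-- **Uniform dissipation bound, extended form**: for `α ≠ 0`,
`∫⁻_{(0,T)} D_α(U n) ≤ ofReal (½ ∫‖u₀‖²)` in `ℝ≥0∞`, for every `T`.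
[cite: ColomboDelellisDerosa2018, §9 (proof of Thm. 1.1)] -/
theorem IsFracGalerkinScheme.lintegral_eFracDissipation_le (hS : IsFracGalerkinScheme α u₀ N U)
    (hα : α ≠ 0) (hu₀ : MemLp u₀ 2 volume) (n : ℕ) (T : ℝ) :
    ∫⁻ t in Ioo 0 T, Torus.eFracDissipation α (U n t) ≤ ENNReal.ofReal (2⁻¹ * ∫ x, ‖u₀ x‖ ^ 2) := by
  rcases le_or_gt T 0 with hT | hT
  · rw [Ioo_eq_empty (not_lt.2 hT), Measure.restrict_empty, lintegral_zero_measure]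
    exact bot_le
  · rw [← ENNReal.ofReal_toReal (hS.lintegral_eFracDissipation_lt_top hα hu₀ n T).ne]
    exact ENNReal.ofReal_le_ofReal (hS.toReal_lintegral_eFracDissipation_le hu₀ n le_rfl hT.le)

end Bounds

/-! ## L2: the Galerkin equations tested against single modes; modulus of continuity -/

section Modulus

variable {α : ℝ} {u₀ : UnitAddTorus d → EuclideanSpace ℝ d} {N : ℕ → ℕ}
  {U : ℕ → ℝ → UnitAddTorus d → EuclideanSpace ℝ d}

/-- **The fractional Galerkin equations in Fourier variables, tested against a single mode**:
for `k` in the ball of order `N n`, `z ∈ ℂ^d` transversal to `k`, and `0 ≤ s ≤ t`,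
`Re ⟪Û_n(t,k) - Û_n(s,k), z⟫ = ∫ₛᵗ ∫ (⟪U n, (U n·∇)a⟫ - ⟪U n, (-Δ)^α a⟫)` with `a = Re (e_k • z)`
(the clause `galerkin` with the Galerkin mode `a`; CDLDR 2018, §9, the ODE for the Fourier
coefficients of (NS_reg)). [cite: ColomboDelellisDerosa2018, §9 (NS_reg)] -/
theorem IsFracGalerkinScheme.re_inner_mFourierCoeff_sub_eq (hS : IsFracGalerkinScheme α u₀ N U)
    (n : ℕ) {k : d → ℤ} (hk : k ∈ FunctionSpaces.Torus.freqBall (N n)) {z : EuclideanSpace ℂ d}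
    (hz : ∑ j, (k j : ℂ) * z j = 0) {s t : ℝ} (hs : 0 ≤ s) (hst : s ≤ t) :
    (inner ℂ (mFourierCoeff (FunctionSpaces.EuclideanSpace.complexify ∘ U n t) k -
        mFourierCoeff (FunctionSpaces.EuclideanSpace.complexify ∘ U n s) k) z).re =
      ∫ τ in s..t, ∫ x, (⟪U n τ x, FunctionSpaces.Torus.convect (U n τ) (FunctionSpaces.Torus.realTrigPoly {k} fun _ => z) x⟫ -
        ⟪U n τ x, Torus.fracLaplacian α (FunctionSpaces.Torus.realTrigPoly {k} fun _ => z) x⟫) := by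
  have h := hS.galerkin n _ (isGalerkinMode_realTrigPoly_singleton hk hz) s t hs hst
  rw [FunctionSpaces.Torus.integral_inner_realTrigPoly_singleton
      (hS.continuous_slice n (hs.trans hst)).integrable_unitAddTorus,
    FunctionSpaces.Torus.integral_inner_realTrigPoly_singleton (hS.continuous_slice n hs).integrable_unitAddTorus]
    at h
  rw [inner_sub_left, Complex.sub_re]
  exact h

omit [DecidableEq d] in
/-- Pointwise bound for the integrand of the tested fractional Galerkin equations against the
single mode `a = Re (e_k • z)`: with `C_k = #d · 2π |k|` and `σ = (4π²|k|²)^α`,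
`|⟪U, (U·∇)a⟫ - ⟪U, (-Δ)^α a⟫| ≤ (C_k ‖z‖ + σ/2) ‖U‖² + (σ/2) ‖z‖²`
(`‖a‖ ≤ ‖z‖`, `‖(U·∇)a‖ ≤ C_k ‖z‖ ‖U‖`, `(-Δ)^α a = σ a`). [folklore] -/
theorem abs_fracGalerkin_integrand_singleton_le [DecidableEq d] (α : ℝ)
    (u : UnitAddTorus d → EuclideanSpace ℝ d) (k : d → ℤ) (z : EuclideanSpace ℂ d) (x : UnitAddTorus d) :
    |⟪u x, FunctionSpaces.Torus.convect u (FunctionSpaces.Torus.realTrigPoly {k} fun _ => z) x⟫ -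
        ⟪u x, Torus.fracLaplacian α (FunctionSpaces.Torus.realTrigPoly {k} fun _ => z) x⟫| ≤
      (Fintype.card d * (2 * Real.pi * Real.sqrt (FunctionSpaces.Torus.freqNormSq k) * ‖z‖) +
          Torus.fracSymbol α k / 2) * ‖u x‖ ^ 2 + Torus.fracSymbol α k / 2 * ‖z‖ ^ 2 := by
  set a := FunctionSpaces.Torus.realTrigPoly {k} (fun _ => z) with ha
  have hax : ‖a x‖ ≤ ‖z‖ := FunctionSpaces.Torus.norm_realTrigPoly_singleton_le k (fun _ => z) x
  have hσ : 0 ≤ Torus.fracSymbol α k := Torus.fracSymbol_nonneg α k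
  have h1 : |⟪u x, FunctionSpaces.Torus.convect u a x⟫| ≤
      Fintype.card d * (2 * Real.pi * Real.sqrt (FunctionSpaces.Torus.freqNormSq k) * ‖z‖) * ‖u x‖ ^ 2 := by
    refine (abs_real_inner_le_norm _ _).trans ?_
    have hc := FunctionSpaces.Torus.norm_convect_realTrigPoly_singleton_le u k (fun _ => z) x
    calc ‖u x‖ * ‖FunctionSpaces.Torus.convect u a x‖
        ≤ ‖u x‖ * (‖u x‖ * (Fintype.card d * (2 * Real.pi * Real.sqrt (FunctionSpaces.Torus.freqNormSq k) * ‖z‖))) :=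
          mul_le_mul_of_nonneg_left hc (norm_nonneg _)
      _ = Fintype.card d * (2 * Real.pi * Real.sqrt (FunctionSpaces.Torus.freqNormSq k) * ‖z‖) * ‖u x‖ ^ 2 := by
          ring
  have h2 : |⟪u x, Torus.fracLaplacian α a x⟫| ≤
      Torus.fracSymbol α k / 2 * ‖u x‖ ^ 2 + Torus.fracSymbol α k / 2 * ‖z‖ ^ 2 := by
    rw [ha, Torus.fracLaplacian_realTrigPoly_singleton, inner_smul_right, ← ha, abs_mul, abs_of_nonneg hσ]
    have hin : |⟪u x, a x⟫| ≤ ‖u x‖ * ‖z‖ :=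
      (abs_real_inner_le_norm _ _).trans (mul_le_mul_of_nonneg_left hax (norm_nonneg _))
    have hy : ‖u x‖ * ‖z‖ ≤ (‖u x‖ ^ 2 + ‖z‖ ^ 2) / 2 := by
      nlinarith [sq_nonneg (‖u x‖ - ‖z‖)]
    calc Torus.fracSymbol α k * |⟪u x, a x⟫| ≤ Torus.fracSymbol α k * ((‖u x‖ ^ 2 + ‖z‖ ^ 2) / 2) :=
          mul_le_mul_of_nonneg_left (hin.trans hy) hσ
      _ = _ := by ring
  calc |⟪u x, FunctionSpaces.Torus.convect u a x⟫ - ⟪u x, Torus.fracLaplacian α a x⟫|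
      ≤ |⟪u x, FunctionSpaces.Torus.convect u a x⟫| + |⟪u x, Torus.fracLaplacian α a x⟫| := abs_sub _ _
    _ ≤ _ := by linarith [h1, h2]

/-- Slice bound for the tested fractional Galerkin integrand against a single mode: for `t ≥ 0`,
`|∫ (⟪U, (U·∇)a⟫ - ⟪U, (-Δ)^α a⟫)| ≤ (C_k‖z‖ + σ/2) ∫ ‖U n t‖² + (σ/2) ‖z‖²` (integrate the
pointwise bound; the torus has volume one). [folklore] -/
theorem IsFracGalerkinScheme.abs_integral_fracGalerkin_singleton_le
    (hS : IsFracGalerkinScheme α u₀ N U) (n : ℕ) (k : d → ℤ) (z : EuclideanSpace ℂ d) {t : ℝ} (ht : 0 ≤ t) :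
    |∫ x, (⟪U n t x, FunctionSpaces.Torus.convect (U n t) (FunctionSpaces.Torus.realTrigPoly {k} fun _ => z) x⟫ -
        ⟪U n t x, Torus.fracLaplacian α (FunctionSpaces.Torus.realTrigPoly {k} fun _ => z) x⟫)| ≤
      (Fintype.card d * (2 * Real.pi * Real.sqrt (FunctionSpaces.Torus.freqNormSq k) * ‖z‖) +
          Torus.fracSymbol α k / 2) * (∫ x, ‖U n t x‖ ^ 2) + Torus.fracSymbol α k / 2 * ‖z‖ ^ 2 := by
  set A := Fintype.card d * (2 * Real.pi * Real.sqrt (FunctionSpaces.Torus.freqNormSq k) * ‖z‖) +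
    Torus.fracSymbol α k / 2 with hA
  set B := Torus.fracSymbol α k / 2 * ‖z‖ ^ 2 with hB
  have hcu : Continuous (U n t) := hS.continuous_slice n ht
  have hi1 : Integrable (fun x => ‖U n t x‖ ^ 2) volume := (hcu.norm.pow 2).integrable_unitAddTorus
  have hg : Integrable (fun x => A * ‖U n t x‖ ^ 2 + B) volume := (hi1.const_mul A).add (integrable_const B)
  have hpt : ∀ᵐ x ∂volume, ‖⟪U n t x, FunctionSpaces.Torus.convect (U n t) (FunctionSpaces.Torus.realTrigPoly {k} fun _ => z) x⟫ -
      ⟪U n t x, Torus.fracLaplacian α (FunctionSpaces.Torus.realTrigPoly {k} fun _ => z) x⟫‖ ≤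
      A * ‖U n t x‖ ^ 2 + B :=
    ae_of_all _ fun x => by
      rw [Real.norm_eq_abs]
      exact abs_fracGalerkin_integrand_singleton_le α (U n t) k z x
  have h := norm_integral_le_of_norm_le hg hpt
  rw [Real.norm_eq_abs] at h
  refine h.trans (le_of_eq ?_)
  rw [integral_add (hi1.const_mul A) (integrable_const B), integral_const_mul A, integral_const]
  simp [Measure.real]

/-- **L2, quantitative**: for `k` in the ball of order `N n`, `z` transversal to `k`,
`0 ≤ s ≤ t` and a kinetic bound `∫ ‖U n τ‖² ≤ Y` on `[0, ∞)`:
`|Re ⟪Û_n(t,k) - Û_n(s,k), z⟫| ≤ (t - s) ((C_k‖z‖ + σ/2) Y + (σ/2) ‖z‖²)`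
(the time derivatives of the Galerkin coefficients are controlled by the energy bound;
RRS 2016, (4.12)–(4.13) for `α = 1`; Hopf 1951, §4). [folklore] -/
theorem IsFracGalerkinScheme.abs_re_inner_mFourierCoeff_sub_le
    (hS : IsFracGalerkinScheme α u₀ N U) (n : ℕ) {Y : ℝ}
    (hY : ∀ τ, 0 ≤ τ → ∫ x, ‖U n τ x‖ ^ 2 ≤ Y) {k : d → ℤ} (hk : k ∈ FunctionSpaces.Torus.freqBall (N n))
    {z : EuclideanSpace ℂ d} (hz : ∑ j, (k j : ℂ) * z j = 0) {s t : ℝ} (hs : 0 ≤ s) (hst : s ≤ t) :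
    |(inner ℂ (mFourierCoeff (FunctionSpaces.EuclideanSpace.complexify ∘ U n t) k -
        mFourierCoeff (FunctionSpaces.EuclideanSpace.complexify ∘ U n s) k) z).re| ≤
      (t - s) * ((Fintype.card d * (2 * Real.pi * Real.sqrt (FunctionSpaces.Torus.freqNormSq k) * ‖z‖) +
          Torus.fracSymbol α k / 2) * Y + Torus.fracSymbol α k / 2 * ‖z‖ ^ 2) := by
  set A := Fintype.card d * (2 * Real.pi * Real.sqrt (FunctionSpaces.Torus.freqNormSq k) * ‖z‖) +
    Torus.fracSymbol α k / 2 with hA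
  set B := Torus.fracSymbol α k / 2 * ‖z‖ ^ 2 with hB
  have hA0 : 0 ≤ A := by
    have := FunctionSpaces.Torus.freqNormSq_nonneg k
    have := Torus.fracSymbol_nonneg α k
    positivity
  rw [hS.re_inner_mFourierCoeff_sub_eq n hk hz hs hst]
  have hdom : ∀ᵐ τ ∂volume, τ ∈ Ioc s t →
      ‖∫ x, (⟪U n τ x, FunctionSpaces.Torus.convect (U n τ) (FunctionSpaces.Torus.realTrigPoly {k} fun _ => z) x⟫ -
        ⟪U n τ x, Torus.fracLaplacian α (FunctionSpaces.Torus.realTrigPoly {k} fun _ => z) x⟫)‖ ≤ A * Y + B := by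
    refine ae_of_all _ fun τ hτ => ?_
    have hτ0 : 0 ≤ τ := hs.trans hτ.1.le
    rw [Real.norm_eq_abs]
    have h0 := hS.abs_integral_fracGalerkin_singleton_le n k z hτ0
    rw [← hA, ← hB] at h0
    refine h0.trans ?_
    have : A * (∫ x, ‖U n τ x‖ ^ 2) ≤ A * Y := mul_le_mul_of_nonneg_left (hY τ hτ0) hA0
    linarith
  have h1 := intervalIntegral.norm_integral_le_of_norm_le hst hdom intervalIntegrable_const
  rw [Real.norm_eq_abs, intervalIntegral.integral_const, smul_eq_mul] at h1
  exact h1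

/-- **L2: uniform Lipschitz modulus of the Fourier coefficients** (CDLDR 2018, §9 via the
`α = 1` template RRS 2016, Thm. 4.4 Step 3 and Ex. 4.2; Hopf 1951, §4: the coefficient curves
`t ↦ Û_n(t,k)` are equicontinuous, uniformly in `n`). For `u₀ ∈ L²` and every frequency `k`
there is `K ≥ 0` with `‖Û_n(t,k) - Û_n(s,k)‖² ≤ K (t - s)` whenever `0 ≤ s ≤ t` and `|k| ≤ N n`
(test the Galerkin equations with `z = Û_n(t,k) - Û_n(s,k)`, transversal since the slices are
divergence free, and use `‖z‖² ≤ 4∫‖u₀‖²`). [folklore] -/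
theorem IsFracGalerkinScheme.exists_modulus_mFourierCoeff
    (hS : IsFracGalerkinScheme α u₀ N U) (hu₀ : MemLp u₀ 2 volume) (k : d → ℤ) :
    ∃ K : ℝ, 0 ≤ K ∧ ∀ n, k ∈ FunctionSpaces.Torus.freqBall (N n) → ∀ s t, 0 ≤ s → s ≤ t →
      ‖mFourierCoeff (FunctionSpaces.EuclideanSpace.complexify ∘ U n t) k -
        mFourierCoeff (FunctionSpaces.EuclideanSpace.complexify ∘ U n s) k‖ ^ 2 ≤ K * (t - s) := by
  obtain ⟨Y, hYdef⟩ : ∃ Y : ℝ, Y = ∫ x, ‖u₀ x‖ ^ 2 := ⟨_, rfl⟩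
  have hY0 : 0 ≤ Y := by rw [hYdef]; exact integral_nonneg fun x => by positivity
  have hY : ∀ n τ, 0 ≤ τ → ∫ x, ‖U n τ x‖ ^ 2 ≤ Y := fun n τ hτ => by
    rw [hYdef]; exact hS.integral_norm_sq_le hu₀ n hτ
  obtain ⟨Ck, hCk⟩ : ∃ Ck : ℝ,
      Ck = Fintype.card d * (2 * Real.pi * Real.sqrt (FunctionSpaces.Torus.freqNormSq k)) := ⟨_, rfl⟩
  have hCk0 : 0 ≤ Ck := by rw [hCk]; positivity
  have hσ : 0 ≤ Torus.fracSymbol α k := Torus.fracSymbol_nonneg α k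
  refine ⟨(Ck * ((1 + 4 * Y) / 2) + Torus.fracSymbol α k / 2) * Y + Torus.fracSymbol α k / 2 * (4 * Y), by positivity,
    fun n hk s t hs hst => ?_⟩
  obtain ⟨z, hz⟩ : ∃ z : EuclideanSpace ℂ d,
      z = mFourierCoeff (FunctionSpaces.EuclideanSpace.complexify ∘ U n t) k -
        mFourierCoeff (FunctionSpaces.EuclideanSpace.complexify ∘ U n s) k := ⟨_, rfl⟩
  rw [← hz]
  have hzT : ∑ j, (k j : ℂ) * z j = 0 := by
    simp only [hz, PiLp.sub_apply, mul_sub, Finset.sum_sub_distrib]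
    rw [hS.sum_mul_mFourierCoeff_eq_zero n (hs.trans hst) k, hS.sum_mul_mFourierCoeff_eq_zero n hs k,
      sub_zero]
  have hzsq : ‖z‖ ^ 2 ≤ 4 * Y := by
    have h1 := (hS.norm_mFourierCoeff_sq_le n (hs.trans hst) k).trans (hY n t (hs.trans hst))
    have h2 := (hS.norm_mFourierCoeff_sq_le n hs k).trans (hY n s hs)
    have h3 : ‖z‖ ≤ ‖mFourierCoeff (FunctionSpaces.EuclideanSpace.complexify ∘ U n t) k‖ +
        ‖mFourierCoeff (FunctionSpaces.EuclideanSpace.complexify ∘ U n s) k‖ := by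
      rw [hz]; exact norm_sub_le _ _
    have h4 : ‖z‖ ^ 2 ≤ (‖mFourierCoeff (FunctionSpaces.EuclideanSpace.complexify ∘ U n t) k‖ +
        ‖mFourierCoeff (FunctionSpaces.EuclideanSpace.complexify ∘ U n s) k‖) ^ 2 :=
      pow_le_pow_left₀ (norm_nonneg _) h3 2
    nlinarith [h4, sq_nonneg (‖mFourierCoeff (FunctionSpaces.EuclideanSpace.complexify ∘ U n t) k‖ -
      ‖mFourierCoeff (FunctionSpaces.EuclideanSpace.complexify ∘ U n s) k‖)]
  have hz1 : ‖z‖ ≤ (1 + 4 * Y) / 2 := by nlinarith [sq_nonneg (‖z‖ - 1), norm_nonneg z]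
  have hmain := hS.abs_re_inner_mFourierCoeff_sub_le n (fun τ hτ => hY n τ hτ) hk hzT hs hst
  rw [← hz] at hmain
  have hre : (inner ℂ z z).re = ‖z‖ ^ 2 := by rw [inner_self_eq_norm_sq_to_K]; norm_cast
  rw [hre, abs_of_nonneg (sq_nonneg _)] at hmain
  have hts : 0 ≤ t - s := sub_nonneg.2 hst
  have hcoef : (Fintype.card d * (2 * Real.pi * Real.sqrt (FunctionSpaces.Torus.freqNormSq k) * ‖z‖) +
      Torus.fracSymbol α k / 2) * Y + Torus.fracSymbol α k / 2 * ‖z‖ ^ 2 ≤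
      (Ck * ((1 + 4 * Y) / 2) + Torus.fracSymbol α k / 2) * Y + Torus.fracSymbol α k / 2 * (4 * Y) := by
    have e1 : Fintype.card d * (2 * Real.pi * Real.sqrt (FunctionSpaces.Torus.freqNormSq k) * ‖z‖) = Ck * ‖z‖ := by
      rw [hCk]; ring
    rw [e1]
    have i0 : Ck * ‖z‖ ≤ Ck * ((1 + 4 * Y) / 2) := mul_le_mul_of_nonneg_left hz1 hCk0
    have i1 : (Ck * ‖z‖ + Torus.fracSymbol α k / 2) * Y ≤ (Ck * ((1 + 4 * Y) / 2) + Torus.fracSymbol α k / 2) * Y :=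
      mul_le_mul_of_nonneg_right (by linarith) hY0
    have i2 : Torus.fracSymbol α k / 2 * ‖z‖ ^ 2 ≤ Torus.fracSymbol α k / 2 * (4 * Y) :=
      mul_le_mul_of_nonneg_left hzsq (by positivity)
    linarith
  calc ‖z‖ ^ 2 ≤ (t - s) * ((Fintype.card d * (2 * Real.pi * Real.sqrt (FunctionSpaces.Torus.freqNormSq k) * ‖z‖) +
        Torus.fracSymbol α k / 2) * Y + Torus.fracSymbol α k / 2 * ‖z‖ ^ 2) := hmain
    _ ≤ (t - s) * ((Ck * ((1 + 4 * Y) / 2) + Torus.fracSymbol α k / 2) * Y + Torus.fracSymbol α k / 2 * (4 * Y)) :=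
        mul_le_mul_of_nonneg_left hcoef hts
    _ = _ := by ring

/-- **L2: uniform equicontinuity of the Fourier coefficients** (`ε`–`δ` form): for `u₀ ∈ L²`,
every frequency `k` and `ε > 0` there is `δ > 0` with `‖Û_n(t,k) - Û_n(s,k)‖ < ε` whenever
`0 ≤ s ≤ t`, `t - s < δ` and `|k| ≤ N n`. [folklore] -/
theorem IsFracGalerkinScheme.equicontinuous_mFourierCoeff
    (hS : IsFracGalerkinScheme α u₀ N U) (hu₀ : MemLp u₀ 2 volume) (k : d → ℤ) {ε : ℝ} (hε : 0 < ε) :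
    ∃ δ > 0, ∀ n, k ∈ FunctionSpaces.Torus.freqBall (N n) → ∀ s t, 0 ≤ s → s ≤ t → t - s < δ →
      ‖mFourierCoeff (FunctionSpaces.EuclideanSpace.complexify ∘ U n t) k -
        mFourierCoeff (FunctionSpaces.EuclideanSpace.complexify ∘ U n s) k‖ < ε := by
  obtain ⟨K, hK0, hK⟩ := hS.exists_modulus_mFourierCoeff hu₀ k
  refine ⟨ε ^ 2 / (K + 1), by positivity, fun n hk s t hs hst hδ => ?_⟩
  have h1 := hK n hk s t hs hst
  have hsq : ‖mFourierCoeff (FunctionSpaces.EuclideanSpace.complexify ∘ U n t) k -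
      mFourierCoeff (FunctionSpaces.EuclideanSpace.complexify ∘ U n s) k‖ ^ 2 < ε ^ 2 := by
    have hK1 : 0 < K + 1 := by linarith
    have h2 : K * (t - s) < ε ^ 2 := by
      calc K * (t - s) ≤ (K + 1) * (t - s) := mul_le_mul_of_nonneg_right (by linarith) (sub_nonneg.2 hst)
        _ < (K + 1) * (ε ^ 2 / (K + 1)) := mul_lt_mul_of_pos_left hδ hK1
        _ = ε ^ 2 := by field_simp
    exact lt_of_le_of_lt h1 h2
  have h := abs_lt_of_sq_lt_sq hsq hε.le
  rwa [abs_of_nonneg (norm_nonneg _)] at h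

end Modulus

/-! ## L3: extraction of a subsequence converging at every time and frequency -/

section Extraction

variable {α : ℝ} {u₀ : UnitAddTorus d → EuclideanSpace ℝ d} {N : ℕ → ℕ}
  {U : ℕ → ℝ → UnitAddTorus d → EuclideanSpace ℝ d}

/-- Every frequency eventually lies in the Galerkin balls: `|k| ≤ N n` for all large `n`. [folklore] -/
theorem IsFracGalerkinScheme.eventually_mem_freqBall (hS : IsFracGalerkinScheme α u₀ N U)
    (k : d → ℤ) : ∀ᶠ n in atTop, k ∈ FunctionSpaces.Torus.freqBall (N n) := by
  obtain ⟨M, hM⟩ := exists_nat_ge (FunctionSpaces.Torus.freqNormSq k)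
  filter_upwards [hS.tendsto_order.eventually (eventually_ge_atTop (M + 1))] with n hn
  rw [FunctionSpaces.Torus.mem_freqBall]
  have h1 : (M : ℝ) + 1 ≤ N n := by exact_mod_cast hn
  have hM0 : (0 : ℝ) ≤ M := Nat.cast_nonneg M
  nlinarith

/-- **L3: extraction** (CDLDR 2018, §9: "we can extract a subsequence … with a standard diagonal
argument"; carried out as in Hopf 1951, §4 / RRS 2016, Thm. 4.4 Step 3, Ex. 4.2–4.4: Arzelà–Ascoli
for the coefficient curves). For `u₀ ∈ L²` there are a subsequence `φ` and limit coefficients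
`c : [0, ∞) × ℤ^d → ℂ^d` with `Û_{φ j}(t, k) → c t k` for **every** `t ≥ 0` and every `k`
(Tychonoff over `ℚ × ℤ^d` and `IsCompact.tendsto_subseq` for the rational times; the uniform
modulus `equicontinuous_mFourierCoeff` makes the subsequence Cauchy at every real time).
[cite: ColomboDelellisDerosa2018, §9 (proof of Thm. 1.1)] -/
theorem IsFracGalerkinScheme.exists_subseq_tendsto_mFourierCoeff
    (hS : IsFracGalerkinScheme α u₀ N U) (hu₀ : MemLp u₀ 2 volume) :
    ∃ φ : ℕ → ℕ, StrictMono φ ∧ ∃ c : ℝ → (d → ℤ) → EuclideanSpace ℂ d,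
      ∀ t, 0 ≤ t → ∀ k, Tendsto (fun j => mFourierCoeff (FunctionSpaces.EuclideanSpace.complexify ∘ U (φ j) t) k)
        atTop (𝓝 (c t k)) := by
  set R : ℝ := Real.sqrt (∫ x, ‖u₀ x‖ ^ 2) with hRdef
  have hR : ∀ t, 0 ≤ t → ∀ n k, ‖mFourierCoeff (FunctionSpaces.EuclideanSpace.complexify ∘ U n t) k‖ ≤ R :=
    fun t ht n k => hS.norm_mFourierCoeff_le hu₀ n ht k
  let x : ℕ → (ℚ × (d → ℤ)) → EuclideanSpace ℂ d := fun n p =>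
    mFourierCoeff (FunctionSpaces.EuclideanSpace.complexify ∘ U n (max (p.1 : ℝ) 0)) p.2
  let s : Set ((ℚ × (d → ℤ)) → EuclideanSpace ℂ d) := Set.pi univ fun _ => Metric.closedBall 0 R
  have hs : IsCompact s := isCompact_univ_pi fun _ => isCompact_closedBall _ _
  have hx : ∀ n, x n ∈ s := fun n => by
    refine mem_univ_pi.2 fun p => ?_
    rw [Metric.mem_closedBall, dist_zero_right]
    exact hR _ (le_max_right _ _) n p.2
  obtain ⟨a, -, φ, hφ, hlim⟩ := hs.tendsto_subseq hx
  rw [tendsto_pi_nhds] at hlim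
  have hrat : ∀ (q : ℚ), (0 : ℝ) ≤ q → ∀ k,
      Tendsto (fun j => mFourierCoeff (FunctionSpaces.EuclideanSpace.complexify ∘ U (φ j) q) k) atTop
        (𝓝 (a (q, k))) := by
    intro q hq k
    have h := hlim (q, k)
    have heq : (fun j => x (φ j) (q, k)) =
        fun j => mFourierCoeff (FunctionSpaces.EuclideanSpace.complexify ∘ U (φ j) q) k := by
      funext j
      simp only [x, max_eq_left hq]
    rw [← heq]
    exact h
  have hcauchy : ∀ t, 0 ≤ t → ∀ k,
      CauchySeq fun j => mFourierCoeff (FunctionSpaces.EuclideanSpace.complexify ∘ U (φ j) t) k := by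
    intro t ht k
    rw [Metric.cauchySeq_iff]
    intro ε hε
    obtain ⟨δ, hδ, hmod⟩ := hS.equicontinuous_mFourierCoeff hu₀ k (by positivity : 0 < ε / 3)
    obtain ⟨q, hq1, hq2⟩ := exists_rat_btwn (show t < t + δ by linarith)
    have hq0 : (0 : ℝ) ≤ q := ht.trans hq1.le
    have hqt : (q : ℝ) - t < δ := by linarith
    have hball : ∀ᶠ j in atTop, k ∈ FunctionSpaces.Torus.freqBall (N (φ j)) :=
      hφ.tendsto_atTop.eventually (hS.eventually_mem_freqBall k)
    have hcq := (hrat q hq0 k).cauchySeq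
    rw [Metric.cauchySeq_iff] at hcq
    obtain ⟨N₁, hN₁⟩ := hcq (ε / 3) (by positivity)
    obtain ⟨N₂, hN₂⟩ := eventually_atTop.1 hball
    refine ⟨max N₁ N₂, fun m hm n hn => ?_⟩
    have hm1 : N₁ ≤ m := (le_max_left _ _).trans hm
    have hn1 : N₁ ≤ n := (le_max_left _ _).trans hn
    have hm2 : k ∈ FunctionSpaces.Torus.freqBall (N (φ m)) := hN₂ m ((le_max_right _ _).trans hm)
    have hn2 : k ∈ FunctionSpaces.Torus.freqBall (N (φ n)) := hN₂ n ((le_max_right _ _).trans hn)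
    have e1 := hmod (φ m) hm2 t q ht hq1.le hqt
    have e2 := hN₁ m hm1 n hn1
    have e3 := hmod (φ n) hn2 t q ht hq1.le hqt
    rw [dist_eq_norm] at e2 ⊢
    calc ‖mFourierCoeff (FunctionSpaces.EuclideanSpace.complexify ∘ U (φ m) t) k -
          mFourierCoeff (FunctionSpaces.EuclideanSpace.complexify ∘ U (φ n) t) k‖
        = ‖-(mFourierCoeff (FunctionSpaces.EuclideanSpace.complexify ∘ U (φ m) q) k -
              mFourierCoeff (FunctionSpaces.EuclideanSpace.complexify ∘ U (φ m) t) k) +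
            (mFourierCoeff (FunctionSpaces.EuclideanSpace.complexify ∘ U (φ m) q) k -
              mFourierCoeff (FunctionSpaces.EuclideanSpace.complexify ∘ U (φ n) q) k) +
            (mFourierCoeff (FunctionSpaces.EuclideanSpace.complexify ∘ U (φ n) q) k -
              mFourierCoeff (FunctionSpaces.EuclideanSpace.complexify ∘ U (φ n) t) k)‖ := by
          congr 1; abel
      _ ≤ ‖-(mFourierCoeff (FunctionSpaces.EuclideanSpace.complexify ∘ U (φ m) q) k -
              mFourierCoeff (FunctionSpaces.EuclideanSpace.complexify ∘ U (φ m) t) k)‖ +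
            ‖mFourierCoeff (FunctionSpaces.EuclideanSpace.complexify ∘ U (φ m) q) k -
              mFourierCoeff (FunctionSpaces.EuclideanSpace.complexify ∘ U (φ n) q) k‖ +
            ‖mFourierCoeff (FunctionSpaces.EuclideanSpace.complexify ∘ U (φ n) q) k -
              mFourierCoeff (FunctionSpaces.EuclideanSpace.complexify ∘ U (φ n) t) k‖ :=
          norm_add₃_le
      _ < ε / 3 + ε / 3 + ε / 3 := by
          rw [norm_neg]
          exact add_lt_add (add_lt_add e1 e2) e3
      _ = ε := by ring
  refine ⟨φ, hφ, fun t k => limUnder atTop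
    (fun j => mFourierCoeff (FunctionSpaces.EuclideanSpace.complexify ∘ U (φ j) t) k), fun t ht k => ?_⟩
  exact tendsto_nhds_limUnder (cauchySeq_tendsto_of_complete (hcauchy t ht k))

end Extraction

/-! ## The limit coefficients -/

section LimitCoefficients

variable {α : ℝ} {u₀ : UnitAddTorus d → EuclideanSpace ℝ d} {N : ℕ → ℕ}
  {U : ℕ → ℝ → UnitAddTorus d → EuclideanSpace ℝ d}
  {c : ℝ → (d → ℤ) → EuclideanSpace ℂ d}

/-- **The limit coefficients at time `0` are those of the datum**: `c 0 k = û₀(k)`. [folklore] -/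
theorem IsFracGalerkinScheme.limit_zero_eq (hS : IsFracGalerkinScheme α u₀ N U)
    (hu₀ : MemLp u₀ 2 volume) (hdiv : FunctionSpaces.Torus.IsWeaklyDivFree u₀)
    (hc : ∀ t, 0 ≤ t → ∀ k, Tendsto (fun n => mFourierCoeff (FunctionSpaces.EuclideanSpace.complexify ∘ U n t) k)
      atTop (𝓝 (c t k))) (k : d → ℤ) :
    c 0 k = mFourierCoeff (FunctionSpaces.EuclideanSpace.complexify ∘ u₀) k := by
  refine tendsto_nhds_unique (hc 0 le_rfl k) (tendsto_const_nhds.congr' ?_)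
  filter_upwards [hS.eventually_mem_freqBall k] with n hn
  exact (hS.mFourierCoeff_zero_eq hu₀ hdiv n hn).symm

/-- **The limit coefficients are transversal**: `∑ⱼ kⱼ (c t k)ⱼ = 0` for `t ≥ 0`. [folklore] -/
theorem IsFracGalerkinScheme.sum_mul_limit_eq_zero (hS : IsFracGalerkinScheme α u₀ N U)
    (hc : ∀ t, 0 ≤ t → ∀ k, Tendsto (fun n => mFourierCoeff (FunctionSpaces.EuclideanSpace.complexify ∘ U n t) k)
      atTop (𝓝 (c t k))) {t : ℝ} (ht : 0 ≤ t) (k : d → ℤ) :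
    ∑ j, (k j : ℂ) * c t k j = 0 := by
  have hcont : Continuous fun w : EuclideanSpace ℂ d => ∑ j, (k j : ℂ) * w j :=
    continuous_finsetSum _ fun j _ => continuous_const.mul (EuclideanSpace.proj j).continuous
  have h1 : Tendsto (fun n => ∑ j, (k j : ℂ) * mFourierCoeff (FunctionSpaces.EuclideanSpace.complexify ∘ U n t) k j)
      atTop (𝓝 (∑ j, (k j : ℂ) * c t k j)) := (hcont.tendsto _).comp (hc t ht k)
  have h2 : (fun n => ∑ j, (k j : ℂ) * mFourierCoeff (FunctionSpaces.EuclideanSpace.complexify ∘ U n t) k j) =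
      fun _ => 0 := funext fun n => hS.sum_mul_mFourierCoeff_eq_zero n ht k
  rw [h2] at h1
  exact tendsto_nhds_unique h1 tendsto_const_nhds

/-- **The limit coefficients are conjugate symmetric**: `c t (-k) = conj (c t k)` for `t ≥ 0`. [folklore] -/
theorem IsFracGalerkinScheme.isConjSymm_limit (hS : IsFracGalerkinScheme α u₀ N U)
    (hc : ∀ t, 0 ≤ t → ∀ k, Tendsto (fun n => mFourierCoeff (FunctionSpaces.EuclideanSpace.complexify ∘ U n t) k)
      atTop (𝓝 (c t k))) {t : ℝ} (ht : 0 ≤ t) : FunctionSpaces.Torus.IsConjSymm (c t) := by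
  intro k
  have h1 : Tendsto (fun n => mFourierCoeff (FunctionSpaces.EuclideanSpace.complexify ∘ U n t) (-k)) atTop
      (𝓝 (FunctionSpaces.EuclideanSpace.conjVec (c t k))) := by
    have h := ((FunctionSpaces.EuclideanSpace.conjVecL (ι := d)).continuous.tendsto _).comp (hc t ht k)
    refine h.congr fun n => ?_
    simp only [Function.comp_apply, FunctionSpaces.EuclideanSpace.conjVecL_apply]
    exact ((hS.isConjSymm_mFourierCoeff n ht) k).symm
  exact tendsto_nhds_unique (hc t ht (-k)) h1

/-- **Finite Parseval sums of the limit coefficients obey the uniform energy bound**: for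
`t ≥ 0` and every finite set of frequencies `S`, `∑_{k∈S} ‖c t k‖² ≤ ∫ ‖u₀‖²` (finite sums pass
to the limit in `∫‖U n t‖² ≤ ∫‖u₀‖²`). [folklore] -/
theorem IsFracGalerkinScheme.sum_norm_sq_limit_le (hS : IsFracGalerkinScheme α u₀ N U)
    (hu₀ : MemLp u₀ 2 volume)
    (hc : ∀ t, 0 ≤ t → ∀ k, Tendsto (fun n => mFourierCoeff (FunctionSpaces.EuclideanSpace.complexify ∘ U n t) k)
      atTop (𝓝 (c t k))) {t : ℝ} (ht : 0 ≤ t) (S : Finset (d → ℤ)) :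
    ∑ k ∈ S, ‖c t k‖ ^ 2 ≤ ∫ x, ‖u₀ x‖ ^ 2 := by
  have hlim : Tendsto (fun n => ∑ k ∈ S, ‖mFourierCoeff (FunctionSpaces.EuclideanSpace.complexify ∘ U n t) k‖ ^ 2)
      atTop (𝓝 (∑ k ∈ S, ‖c t k‖ ^ 2)) :=
    tendsto_finsetSum _ fun k _ => ((hc t ht k).norm).pow 2
  refine le_of_tendsto' hlim fun n => ?_
  have h1 : ∑ k ∈ S, ‖mFourierCoeff (FunctionSpaces.EuclideanSpace.complexify ∘ U n t) k‖ ^ 2 ≤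
      ∫ x, ‖U n t x‖ ^ 2 :=
    sum_le_hasSum S (fun k _ => sq_nonneg _)
      (FunctionSpaces.Torus.hasSum_sq_norm_mFourierCoeff_complexify (hS.memLp_slice n ht))
  exact h1.trans (hS.integral_norm_sq_le hu₀ n ht)

/-- **The limit coefficients are continuous in time** on `[0, ∞)` (the uniform modulus of
`exists_modulus_mFourierCoeff` passes to the limit: `‖c t k - c s k‖² ≤ K (t - s)`). [folklore] -/
theorem IsFracGalerkinScheme.continuousOn_limit (hS : IsFracGalerkinScheme α u₀ N U)
    (hu₀ : MemLp u₀ 2 volume)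
    (hc : ∀ t, 0 ≤ t → ∀ k, Tendsto (fun n => mFourierCoeff (FunctionSpaces.EuclideanSpace.complexify ∘ U n t) k)
      atTop (𝓝 (c t k))) (k : d → ℤ) :
    ContinuousOn (fun t => c t k) (Ici 0) := by
  have hmod : ∀ {ε : ℝ}, 0 < ε → ∃ δ > 0, ∀ s t, 0 ≤ s → s ≤ t → t - s < δ → ‖c t k - c s k‖ ≤ ε := by
    intro ε hε
    obtain ⟨δ, hδ, h⟩ := hS.equicontinuous_mFourierCoeff hu₀ k hε
    refine ⟨δ, hδ, fun s t hs hst hts => ?_⟩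
    have hlim : Tendsto (fun n => ‖mFourierCoeff (FunctionSpaces.EuclideanSpace.complexify ∘ U n t) k -
        mFourierCoeff (FunctionSpaces.EuclideanSpace.complexify ∘ U n s) k‖) atTop (𝓝 ‖c t k - c s k‖) :=
      ((hc t (hs.trans hst) k).sub (hc s hs k)).norm
    refine le_of_tendsto hlim ?_
    filter_upwards [hS.eventually_mem_freqBall k] with n hn
    exact (h n hn s t hs hst hts).le
  intro t₀ ht₀
  rw [mem_Ici] at ht₀
  rw [ContinuousWithinAt, Metric.tendsto_nhds]
  intro ε hε
  obtain ⟨δ, hδ, h⟩ := hmod (half_pos hε)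
  have hball : ∀ᶠ t in 𝓝[Ici 0] t₀, dist t t₀ < δ :=
    Metric.tendsto_nhds.1 tendsto_id _ hδ |>.filter_mono nhdsWithin_le_nhds
  filter_upwards [hball, self_mem_nhdsWithin] with t ht hts
  rw [mem_Ici] at hts
  rw [Real.dist_eq] at ht
  rw [dist_eq_norm]
  rcases le_total t t₀ with hle | hle
  · have := h t t₀ hts hle (by rw [abs_lt] at ht; linarith)
    rw [norm_sub_rev]
    linarith
  · have := h t₀ t ht₀ hle (by rw [abs_lt] at ht; linarith)
    linarith

end LimitCoefficients

end Literature.Analysis.FluidPDE
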